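import Mathlib
import HarnessLib
import HarnessLib.Audit
import Summits.RiemannHypothesis.Statement
import Literature.NumberTheory.LFunctions.GeneralizedRH

/-!
Route: Horocycle

CLOSED (superseded) 2026-08-15T10:46:55Z by planner-RiemannHypothesis-route-RiemannHypothesis-Horocycle-0 — reason: superseded:route-RiemannHypothesis-Strip — superseded by route-RiemannHypothesis-Strip — note: SUPERSEDED by route-RiemannHypothesis-Strip (route-repair planner 2026-08-15; retriage 2026-08-14 had flagged UNDER FLOOR and recommended 'fold into Strip unless a genuinely dynamical crux is filed'). CENSUS. WHAT IT WAS: Zagier's 1981 criterion (Zagier1981 §1 pp.279-280; Sarnak1981 Thm 1): closed-h. The file is kept as the record of this route; refuted decls are indexed as negative knowledge (`ledger negatives`).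

# Route Horocycle — RH as an equidistribution RATE for closed horocycles on the modular surface

**Thesis X (words).** For every smooth `SL(2,ℤ)`-invariant `F` on the upper half plane vanishing
high in the cusp,
the average of `F` over the closed horocycle of height `y`, `m_F(y) = ∫₀¹ F(x+iy) dx`, converges to
a constant with
error `O(y^{3/4−ε})` for every `ε > 0` as `y → 0⁺` ("HorocycleRate (3/4)").

**X (Lean, elaborated in Sketch2.lean; all constants Mathlib: `ContDiffOn`,
`Matrix.SpecialLinearGroup`,
`UpperHalfPlane` with its `SL(2,ℤ)` action, `ModularGroup.fd`, `Asymptotics.IsBigO`, `nhdsWithin`,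
interval integral).**
`∀ F : ℂ → ℂ, ContDiffOn ℝ (⊤ : ℕ∞) F {z : ℂ | 0 < z.im} → (∀ (g : Matrix.SpecialLinearGroup (Fin 2)
ℤ) (z :
UpperHalfPlane), F ↑(g • z) = F ↑z) → (∃ Y : ℝ, ∀ z : UpperHalfPlane, z ∈ ModularGroup.fd → Y < z.im
→ F ↑z = 0) →
∃ c : ℂ, ∀ ε : ℝ, 0 < ε → Asymptotics.IsBigO (nhdsWithin (0 : ℝ) (Set.Ioi 0)) (fun y : ℝ => (∫ x in
(0 : ℝ)..1,
F (↑x + ↑y * Complex.I)) - c) (fun y : ℝ => y ^ (3 / 4 - ε))`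
(Smoothness is required on `{im > 0}` only: a Γ-invariant cusp-supported `F` is discontinuous at
every real point, so
`ContDiff` on ℂ would make X vacuous. `HorocycleRate θ` below = the same Prop with `3/4` replaced by
`θ`.)

**Why this line (import: homogeneous dynamics / spectral theory of Γ\H).** Zagier's theorem
[Zagier1981; also
Sarnak1981 for closed horocycles on Γ\SL₂(ℝ)]: the Mellin transform of `m_F` is the Rankin–Selberg
integral
`∫ F·E(·,s)`, whose poles are `s = 1` and `s = ρ/2` (`ξ(2s)` in the denominator of the Eisenstein
series), so
`m_F(y) = c_F + Σ_ρ a_ρ(F) y^{1−ρ/2} + …`; unconditionally the error is `O(y^{1/2})`, and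
`O(y^{3/4−ε}) ∀F` ⇔ RH. More
generally rate `θ` ⇔ quasi-RH at abscissa `2 − 2θ` (crux #4), so ANY dynamical/ergodic proof of a
rate `y^{1/2+δ}`
(mixing of the geodesic flow, Ratner/Burger/Strömbergsson effective equidistribution
[Strombergsson2004], Venkatesh-style
effective methods) is a zero-free strip — the object provers manipulate is a flow on a finite-volume
homogeneous space,
not ζ. Honest caveat, part of the thesis: [FlaminioForni2003] show the deviation of horocycle
ergodic averages is
governed by flow-invariant distributions, among them one per zero `ρ` with exponent exactly `Re
ρ/2`; a purely
dynamical gain must therefore prove vanishing/decay of those specific obstructions — the route is a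
faithful
re-encoding whose value is the different toolbox, not a known shortcut.

**Ranked cruxes.**
- #2 `∃ θ > 1/2, HorocycleRate θ` — any power gain over the unconditional exponent; ⇔ a zero-free
strip
  `Re s > 2 − 2θ` by #4 (same strength as route Strip's crux #2, stmt-RiemannHypothesis-0349;
refuter should link them).
  Hardest and most informative.
- #3 `HorocycleRate (1/2)` without the `ε` (unconditional Zagier–Sarnak rate `O(y^{1/2})`) — theorem
in print
  [Zagier1981; Sarnak1981 Thm 1]; formal target that builds the real-analytic Eisenstein series /
Rankin–Selberg
  unfolding API on top of Mathlib's `UpperHalfPlane`/`ModularGroup.fd` (grounder may convert to a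
fact).
- #4 dictionary: `∀ θ ∈ [1/2, 3/4], HorocycleRate θ ↔
Literature.NumberTheory.LFunctions.QuasiRiemannHypothesis (2 − 2θ)` [Zagier1981] — expected to
  become a named fact; the `←` direction is the contour shift, the `→` direction needs `F` with
`a_ρ(F) ≠ 0`.

**Kill criteria.** (i) #4 refuted in the `→` direction for this test-function class (e.g.
cusp-supported smooth `F`
cannot detect some `ρ`) → re-type X over Zagier's rapid-decay class (new definition item), not a
kill. (ii) A theorem
that every proof of `HorocycleRate θ`, `θ > 1/2`, factors through `QuasiRiemannHypothesis (2 − 2θ)`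
in the strong
sense of [FlaminioForni2003] (obstructions are exactly the zeros, with no independent dynamical
handle) → close as
a pure reformulation and fold #3/#4 into Literature.

**Not decomposed yet.** No Γ\SL₂(ℝ) (frame-flow) version, no Sobolev-norm bookkeeping, no choice
among dynamical
methods; discs/Farey-fraction variants (Franel–Landau, Verjovsky) deliberately not filed.

UNDER FLOOR: fewer than 2 cruxes remain after retriage (legacy route; D-0019).

Novelty: NOVELTY (retriage audit 2026-08-14; searched before claiming: `lit search --hybrid "closed
horocycles equidistribution rate Riemann hypothesis Zagier Sarnak modular surface"`, `lit search
--source all "horocycle Riemann hypothesis equidistribution rate"`, `lit frontier RiemannHypothesis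
--since 2015` and `lit bridges RiemannHypothesis --cross any` (no horocycle hits), barrier catalogue
Literature.Barriers.RiemannHypothesis).
Nearest prior art: the thesis X IS Zagier's criterion, Zagier1981 §1 pp.279–280 (unnumbered "second
application"; lit paper:url-53aa71338f2f PDF pp.5–6) and Sarnak1981 Thm 1 (closed horocycles of
length T on SL(2,ℤ)\SL(2,ℝ), smooth compactly supported tests: O(T^{−1/2}) unconditionally,
O(T^{−3/4+ε}) ∀ε ⇔ RH). Restated many times: Verjovsky (arXiv:1711.03593 p.6, 1993 Pitman notes),
Cacciatori–Cardella (arXiv:1007.3717, JHEP 2010: Sp(2g,ℤ) generalisation, rate O(v₁^{g−1/4}) ⇔ RH),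
Estala-Arias (arXiv:1112.1146 Thm 2, Hilbert modular orbifold), I. Vinogradov (arXiv:1607.04769 p.2:
"y^{3/4} … would be equivalent to the Riemann hypothesis"), and as folklore in the
Einsiedler–Mohammadi survey (book:fisher2022-dynamics-geometry-number-theory p.394). Obstruction
theory: FlaminioForni2003 (deviation of horocycle ergodic averages is governed by flow-invariant
distributions; for the closed cuspidal horocycle on the modular surface the surviving exponents are
Re ρ/2, one per zero), Strombergsson2004 (uniform equidistribution of long closed horocycles,
general Γ).
D  [refs: 1711.03593, 1007.3717, 1112.1146, 1607.04769, paper:url-53aa71338f2f, book:fisher2022-dynamics-geometry-number-theory, Zagier1981, Sarnak1981, FlaminioForni2003, Strombergsson2004]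

Barriers (technique_class: homogeneous-dynamics closed-horocycle-rate RH-equivalent): BARRIERS (technique_class: homogeneous-dynamics closed-horocycle-rate RH-equivalent).
- `Literature.Barriers.RiemannHypothesis.DavenportHeilbronn` (functional-equation-only, no Euler
product ⇒ zeros in σ > 1): formally not met — the route never argues from the Dirichlet series or
functional equation of ζ alone; ζ enters as the scattering coefficient φ(s) = ξ(2s−1)/ξ(2s) in the
constant term of the weight-0 Eisenstein series of the ARITHMETIC lattice SL(2,ℤ), and the
Davenport–Heilbronn function is no lattice's scattering determinant. But the route does NOT evade
the underlying "sphere of influence of the Euler product" problem: by Zagier1981 pp.279–280 (Z2) and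
FlaminioForni2003, a rate y^θ with θ > 1/2 for all tests is literally the zero-free half-plane Re s
> 2−2θ, so any dynamical proof must use arithmetic input about SL(2,ℤ) strong enough to imply it.
The bet (no mechanism filed yet): Hecke operators or the adelic extension PGL₂(ℚ)\PGL₂(𝔸) supply
effective-mixing information not visible on the ζ side.
- `Literature.Barriers.RiemannHypothesis.EpsteinZetaRealZeros` (Epstein zeta = E(z_Q, s) at CM
points: real zeros in (1/2,1), and ≫ T zeros off the line when h(d) > 1): does not apply — the
closed-horocycle average of F sees only the CONSTANT TERM y^s + φ(s) y^{1−s} of E(·,s), whose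
singularities are the poles ρ/2 coming from ξ(2s) in the denominator; zeros of s ↦ E(z_Q, s) at
individual points are not poles and contribute nothing to m_F. It is a warning only for pointwise,

History (route lifecycle, newest last):
- 2026-08-15T10:46:55Z · CLOSED superseded — superseded:route-RiemannHypothesis-Strip (planner-RiemannHypothesis-route-RiemannHypothesis-Horocycle-)

sub-problem: RiemannHypothesis · status: closed(superseded) · opened planner-RiemannHypothesis-Survey-0 2026-08-13T06:49:36Z · rev 1 · ledger route-RiemannHypothesis-Horocycle
GENERATED by the gate from the ledger (D-0016/17). Provers cite these decls: `theorem foo : Summit.RiemannHypothesis.RiemannHypothesis.Theses.Horocycle.<Decl> := …` in Summits/RiemannHypothesis/RiemannHypothesis/Theorems/<Name>.lean.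
-/

namespace Summit.RiemannHypothesis.RiemannHypothesis.Theses.Horocycle

open scoped BigOperators Topology Manifold Classical MeasureTheory ProbabilityTheory Matrix InnerProductSpace ComplexConjugate ContinuousMap
open Filter Set Function TopologicalSpace MeasureTheory

attribute [summit_statement] _root_.Summit.RiemannHypothesis

open Summit

/-- item stmt-RiemannHypothesis-0458 · target · rank 0 · closed · moot by None · by planner
why it might fail: X ⇔ RH (Zagier1981 §1 pp.279–280; in tree Literature.NumberTheory.LFunctions.horocycleRate_threeQuarters_iff_of): a zero with Re ρ > 1/2 puts a term a_ρ(F)·y^{1−ρ/2} ≫ y^{3/4−ε} into m_F for admissible F pairing with E*(·,ρ/2); exactly as hard as RH, no independent dynamical handle known (FlaminioFo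
sources: Zagier1981 §1 pp.279-280 (lit paper:url-53aa71338f2f, PDF pp.5-6), Sarnak1981 Thm 1 (paywalled, acq-00188; secondary arXiv:1711.03593 p.6), Literature.NumberTheory.LFunctions.horocycleRate_threeQuarters_iff_of (Literature/NumberTheory/LFunctions/HorocycleRH.lean), paper:arxiv-1007.3717 p.2 (Cacciatori–Cardella 2010), FlaminioForni2003
Thesis X of route Horocycle [Zagier1981; Sarnak1981]: for every F : ℂ → ℂ smooth on {im > 0},
SL(2,ℤ)-invariant, vanishing on {z ∈ ModularGroup.fd | im z > Y} for some Y, there is c (necessarily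
(3/π)∫_{Γ\ℍ} F dμ) with ∫₀¹ F(x+iy) dx − c = O(y^{3/4−ε}) as y → 0⁺ for every ε > 0. 'HorocycleRate
θ' denotes the same Prop with exponent θ − ε. Smoothness deliberately only on the open upper half
plane (Γ-invariant cusp-supported F is discontinuous at ℝ). Equivalent to RH by Zagier's theorem
(crux #4 at θ = 3/4); imports homogeneous dynamics: m_F(y) is the average of F along a closed
horocycle of length 1/y on the unit tangent bundle SL(2,ℤ)\SL(2,ℝ). -/
@[route_item "route-RiemannHypothesis-Horocycle"]
def HorocycleThesis : Prop :=
  ∀ F : ℂ → ℂ, ContDiffOn ℝ (⊤ : ℕ∞) F {z : ℂ | 0 < z.im} → (∀ (g : Matrix.SpecialLinearGroup (Fin 2) ℤ) (z : UpperHalfPlane), F ↑(g • z) = F ↑z) → (∃ Y : ℝ, ∀ z : UpperHalfPlane, z ∈ ModularGroup.fd → Y < z.im → F ↑z = 0) → ∃ c : ℂ, ∀ ε : ℝ, 0 < ε → Asymptotics.IsBigO (nhdsWithin (0 : ℝ) (Set.Ioi 0)) (fun y : ℝ => (∫ x in (0 : ℝ)..1, F (↑x + ↑y * Complex.I)) -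 c) (fun y : ℝ => y ^ (3 / 4 - ε))

/-- item stmt-RiemannHypothesis-0460 · crux · rank 2 · closed · moot by None · by planner
why it might fail: Mod dictionary 0462 it IS a zero-free strip ζ≠0 on Re s>2−2θ (= Strip crux 0349; open since 1896). FlaminioForni2003: obstructions to closed-horocycle rates beyond y^{1/2} are invariant distributions indexed by the zeros ρ; dynamics gains nothing unless it proves the strip. False if sup Re ρ = 1.
sources: FlaminioForni2003, Zagier1981 §1 pp.279-280 (Z2: rate α for all tests ⇒ Θ ≤ 2(1−α)), Strombergsson2004, Sarnak1981 Thm 1, Literature.RH.zeroFreeStrip_of_horocycleRateGain (Summits/RiemannHypothesis/RiemannHypothesis/Theorems/HorocycleAssembly.lean, landed p3625), stmt-RiemannHypothesis-0349 (route Strip crux: ∃ δ>0, QuasiRiemannHypothesis (1−δ) — same strength)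
THE crux: ∃ θ > 1/2 with HorocycleRate θ. By the dictionary (crux #4) this is exactly a zero-free
strip Re s > 2 − 2θ, i.e. the same strength as route Strip crux #2 (stmt-RiemannHypothesis-0349) —
refuter should record the equivalence; the point of filing it here is the different toolbox:
effective equidistribution of long closed horocycles [Sarnak1981; Strombergsson2004], mixing of the
geodesic flow and Margulis thickening, representation-theoretic Sobolev methods. Known: θ = 1/2
unconditionally (crux #3), and [FlaminioForni2003] identify the obstructions to faster
equidistribution as horocycle-invariant distributions, one for each zero ρ (exponent Re ρ/2) besides
those from Maass cusp forms — which contribute nothing here: over the COMPLETE closed horocycle the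
cuspidal part of F integrates to zero (cusp forms have zero constant term), so only the Eisenstein
part of the spectral expansion survives and its only poles are the ρ/2 [Zagier1981 §2]. Open;
RH-implied. -/
@[route_item "route-RiemannHypothesis-Horocycle"]
def HorocycleRateGain : Prop :=
  ∃ θ : ℝ, 1 / 2 < θ ∧ ∀ F : ℂ → ℂ, ContDiffOn ℝ (⊤ : ℕ∞) F {z : ℂ | 0 < z.im} → (∀ (g : Matrix.SpecialLinearGroup (Fin 2) ℤ) (z : UpperHalfPlane), F ↑(g • z) = F ↑z) → (∃ Y : ℝ, ∀ z : UpperHalfPlane, z ∈ ModularGroup.fd → Y < z.im → F ↑z = 0) → ∃ c : ℂ, ∀ ε : ℝ, 0 < ε → Asymptotics.IsBigO (nhdsWithin (0 : ℝ) (Set.Ioi 0)) (fun y : ℝ => (∫ x in (0 : ℝ)..1, F (↑x + ↑y * Complex.I)) - c) (fun y : ℝ => y ^ (θ - ε))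

/-- item stmt-RiemannHypothesis-0461 · support · rank 3 · closed · moot by None · by planner
Theorem in print [Zagier1981 Thm p. 277; Sarnak1981 Thm 1]: for admissible F, m_F(y) = c_F +
O(y^{1/2}). Proof routes: (a) spectral — unfold to R(F,s) = R*(F,s)/ξ(2s), no zeros of ξ(2s) for Re
s ≥ 1/2 (Mathlib riemannZeta_ne_zero_of_one_le_re) plus decay of R* in vertical strips, Mellin
inversion; (b) dynamical — Ratner/Burger-type effective equidistribution from the spectral gap of
SL(2,ℤ)\ℍ (Selberg λ₁ ≥ 3/16 suffices for some rate; 1/2 needs λ₁ ≥ 1/4, true for SL(2,ℤ)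
[Sarnak1981]). Formal target: needs real-analytic Eisenstein series E(z,s) for SL(2,ℤ) with constant
term y^s + (ξ(2s−1)/ξ(2s)) y^{1−s} and the unfolding identity — new Literature layer on Mathlib
UpperHalfPlane/ModularGroup.fd (grounder may convert this crux to a fact and file the definitions). -/
@[route_item "route-RiemannHypothesis-Horocycle"]
def HorocycleRateHalfUnconditional : Prop :=
  ∀ F : ℂ → ℂ, ContDiffOn ℝ (⊤ : ℕ∞) F {z : ℂ | 0 < z.im} → (∀ (g : Matrix.SpecialLinearGroup (Fin 2) ℤ) (z : UpperHalfPlane), F ↑(g • z) = F ↑z) → (∃ Y : ℝ, ∀ z : UpperHalfPlane, z ∈ ModularGroup.fd → Y < z.im → F ↑z = 0) → ∃ c : ℂ, Asymptotics.IsBigO (nhdsWithin (0 : ℝ) (Set.Ioi 0)) (fun y : ℝ => (∫ x in (0 : ℝ)..1, F (↑x + ↑y * Complex.I)) - c) (fun y : ℝ => y ^ ((1 / 2 : ℝ)))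

/-- item stmt-RiemannHypothesis-0462 · support · rank 4 · closed · moot by None · by planner
[Zagier1981 §§2–4]: poles of the Mellin transform of m_F − c_F are at s = ρ/2, so m_F(y) − c_F =
O(y^{θ−ε}) ∀ε ∀F ⇔ every nontrivial zero has Re ρ ≤ 2 − 2θ (and by s ↦ 1 − s symmetry, ≥ 2θ − 1) ⇔
Literature.NumberTheory.LFunctions.QuasiRiemannHypothesis (2 − 2θ) (no zeros with 2 − 2θ < Re s <
1). ← : contour shift using 1/ζ(2s) ≪ |t|^ε to the right of the zero-free half-plane [Titchmarsh1986
Thm 14.2 adapted] and rapid decay of R*(F, s) in |Im s| for smooth cusp-supported F. → : as in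
assembly #1. θ = 3/4 is Zagier's RH criterion; θ = 1/2 is vacuous ↔ vacuous. Expected to be vendored
as a named fact zagier_horocycle_criterion (cite request filed); filed as a crux so the refuter
checks the test-function class (cusp-supported C^∞ on {im > 0} vs Zagier's rapid-decay class) before
provers rely on it. -/
@[route_item "route-RiemannHypothesis-Horocycle"]
def HorocycleRateIffQuasiRH : Prop :=
  ∀ θ : ℝ, 1 / 2 ≤ θ → θ ≤ 3 / 4 → ((∀ F : ℂ → ℂ, ContDiffOn ℝ (⊤ : ℕ∞) F {z : ℂ | 0 < z.im} → (∀ (g : Matrix.SpecialLinearGroup (Fin 2) ℤ) (z : UpperHalfPlane), F ↑(g • z) = F ↑z) → (∃ Y : ℝ, ∀ z : UpperHalfPlane, z ∈ ModularGroup.fd → Y < z.im → F ↑z = 0) → ∃ c : ℂ, ∀ ε : ℝ, 0 < ε → Asymptotics.IsBigO (nhdsWithin (0 : ℝ) (Set.Ioi 0)) (fun y : ℝ => (∫ x in (0 : ℝ)..1, F (↑x + ↑y * Complex.I)) - c) (fun y : ℝ => y ^ (θ - ε))) ↔ Literature.NumberTheory.LFunctions.QuasiRiemannHypothesis (2 -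 2 * θ))

/-- item stmt-RiemannHypothesis-0459 · assembly · rank 1 · closed · moot by None · by planner
Zagier's converse direction [Zagier1981 §§2–4; Sarnak1981 Thm 1]: the Mellin transform ∫₀^∞ (m_F(y)
− c) y^{s−2} dy equals the Rankin–Selberg integral R(F,s) = ∫_{Γ\ℍ} F E(·,s) dμ = R*(F,s)/ξ(2s) with
R* meromorphic with poles only at s = 0, 1; a zero ρ of ξ with Re ρ > 1/2 gives a pole of R(F,·) at
ρ/2 for some admissible F (density of cusp-supported smooth F in L², residue of E at ρ/2 is a
nonzero function), forcing a term of size y^{1−Re ρ/2} ≫ y^{3/4−ε} in m_F — contradiction. Then RH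
from Literature.NumberTheory.LFunctions.QuasiRiemannHypothesis (1/2) via fact
Literature.NumberTheory.LFunctions.quasiRiemannHypothesis_one_half_iff. Expected to be discharged as
(h : zagier_horocycle_criterion) once crux #4 is vendored as a named fact. -/
@[route_item "route-RiemannHypothesis-Horocycle"]
def Assembly : Prop :=
  (∀ F : ℂ → ℂ, ContDiffOn ℝ (⊤ : ℕ∞) F {z : ℂ | 0 < z.im} → (∀ (g : Matrix.SpecialLinearGroup (Fin 2) ℤ) (z : UpperHalfPlane), F ↑(g • z) = F ↑z) → (∃ Y : ℝ, ∀ z : UpperHalfPlane, z ∈ ModularGroup.fd → Y < z.im → F ↑z = 0) → ∃ c : ℂ, ∀ ε : ℝ, 0 < ε → Asymptotics.IsBigO (nhdsWithin (0 : ℝ) (Set.Ioi 0)) (fun y : ℝ => (∫ x in (0 : ℝ)..1, F (↑x + ↑y * Complex.I)) - c) (fun y : ℝ => y ^ (3 / 4 - ε))) → Summit.RiemannHypothesis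

end Summit.RiemannHypothesis.RiemannHypothesis.Theses.Horocycle
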